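import Literature.AnabelianGeometry.SemiGraphs.ProfiniteHomToAnab
import Literature.AnabelianGeometry.SemiGraphs.PullbackFunctor
import Literature.AnabelianGeometry.SemiGraphs.TemperedFunctorialityHomProofs
import Literature.AnabelianGeometry.SemiGraphs.TemperedCoveringsProofs
import Literature.AnabelianGeometry.SemiGraphs.FiniteCoveringsGalois
import HarnessLib

/-!
# [SemiAnbd] §2/§3: pulling back finite étale coverings along `F.toAnab` and along `F` agree

Mochizuki, *Semi-graphs of anabelioids*, Publ. RIMS **42** (2006): Rmk. 2.11.1 p. 32 (a morphism of
semi-graphs of anabelioids determines a morphism `B(𝒢) → B(ℋ)`, i.e. the pull-back functor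
`B(ℋ) ⥤ B(𝒢)`), Def. 3.5 (i)–(ii) p. 37 ("natural full embeddings `B(G) ↪ B^temp(G) ↪ B^cov(G)`"),
Prop. 3.6 (iv) p. 39 ("any morphism of semi-graphs of anabelioids `G' → G` induces … `B^temp(G') →
B^temp(G)` [by pulling back tempered coverings]") [cite: MochizukiSemiAnbd2006, Prop 3.6(iv) p.39].

The tree carries TWO pull-back functors of a §3 morphism `F : 𝒢 ⟶ ℋ` of profinite presentations
(`ProfiniteSemiGraph.Hom`): the §3 one `F.covPullback : B^cov(ℋ) ⥤ B^cov(𝒢)`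
(`TemperedFunctorialityProofs.lean`) and, through the §2 morphism `F.toAnab : 𝒢.toAnab ⟶ ℋ.toAnab`
(`ProfiniteHomToAnab.lean`), the §2 one `F.toAnab.pullbackFunctor : B(ℋ.toAnab) ⥤ B(𝒢.toAnab)`
(`PullbackFunctor.lean`).  Both glue along a branch by a conjugating element CHOSEN from the
compatibility `F.comm` (Rmk. 2.4.2: the compatibility holds only up to conjugation).  This file proves
that the two choices coincide (`Hom.conjElt_eq_conjugator` — they are `Classical.choose` of
propositionally equal predicates) and hence that the two pull-backs AGREE ON THE NOSE along the
comparison functor `ofBObj : B(−.toAnab) ⥤ B^cov(−)` (`FiniteCoveringsComparison.lean`):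
`F.toAnab.pullbackFunctor ⋙ 𝒢.ofBObj ≅ ℋ.ofBObj ⋙ F.covPullback` with identity underlying maps
(`Hom.toAnabPullbackIso`), together with the finite-object forms (`Hom.bfinPullback`,
`Hom.toAnabPullbackIsoFin`, and the chart-shaped `Hom.bfinPullbackIso :
F.bfinPullback ≅ equivBFin⁻¹ ⋙ F.toAnab.pullbackFunctor ⋙ equivBFin`).  (abc-iut cell, layer L3,
bridge item B7c «compatibility of the §3-side pull-back with the §2-side pull-back along
`Hom.toAnab`»; nothing here takes a side on [IUTchIII] Cor. 3.12.)
-/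

noncomputable section

namespace Literature.AnabelianGeometry.SemiGraphs

open CategoryTheory CategoryTheory.Limits
open Literature.AnabelianGeometry.Anabelioids
open Literature.AlgebraicGeometry.Frobenioids (BCat)
open scoped FintypeCatDiscrete Pointwise

universe u

/-- `Classical.choose` depends only on the predicate: equal predicates give equal chosen witnesses
(used for the two chosen conjugating elements of [SemiAnbd] Rmk. 2.4.2).
[cite: MochizukiSemiAnbd2006, Rmk 2.4.2 p.26] -/
theorem classicalChoose_congr {α : Sort*} {p q : α → Prop} (hp : ∃ a, p a) (hq : ∃ a, q a)
    (e : p = q) : Classical.choose hp = Classical.choose hq := by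
  subst e
  rfl

namespace ProfiniteSemiGraph

variable {𝒢 ℋ : ProfiniteSemiGraph.{u}}

/-! ### Isomorphisms of coverings from componentwise isomorphisms -/

/-- An isomorphism of `B^cov(G)` from isomorphisms of the vertex and edge fibres compatible with the
gluings (the compatibility of the inverses follows). [cite: MochizukiSemiAnbd2006, §3 p.36] -/
def CovObj.isoOfComponents {S T : CovObj 𝒢} (eV : ∀ v, S.SV v ≅ T.SV v) (eE : ∀ e, S.SE e ≅ T.SE e)
    (comm : ∀ (b : 𝒢.graph.Branch) (v : 𝒢.graph.Vertex) (h : 𝒢.graph.abuts b = some v),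
      (eE (𝒢.graph.edgeOf b)).hom ≫ (T.glue b v h).hom =
        (S.glue b v h).hom ≫ (BTemp.res (𝒢.brHom b v h)).map (eV v).hom) :
    S ≅ T where
  hom := ⟨fun v => (eV v).hom, fun e => (eE e).hom, comm⟩
  inv := ⟨fun v => (eV v).inv, fun e => (eE e).inv, fun b v h => by
    rw [Iso.inv_comp_eq, ← Functor.mapIso_inv, ← Category.assoc, Iso.eq_comp_inv,
      Functor.mapIso_hom]
    exact (comm b v h).symm⟩
  hom_inv_id := by
    refine CovHom.ext (funext fun v => ?_) (funext fun e => ?_)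
    · exact (eV v).hom_inv_id
    · exact (eE e).hom_inv_id
  inv_hom_id := by
    refine CovHom.ext (funext fun v => ?_) (funext fun e => ?_)
    · exact (eV v).inv_hom_id
    · exact (eE e).inv_hom_id

namespace Hom

variable (F : Hom 𝒢 ℋ)

/-! ### The two chosen conjugating elements coincide -/

/-- The conjugating element chosen in `ProfiniteHomToAnab.lean` (`conjElt`, from `F.comm`) and the one
chosen in `TemperedFunctorialityProofs.lean` (`conjugator`, from `F.exists_conj … rfl
(edgeOf_branchMap b)`) are `Classical.choose` of propositionally EQUAL predicates on `Π_{F v}`,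
hence equal ([SemiAnbd] Rmk. 2.4.2 p. 26: the `φ_b` are given by conjugating elements).
[cite: MochizukiSemiAnbd2006, Rmk 2.4.2 p.26] -/
theorem conjElt_eq_conjugator (b : 𝒢.graph.Branch) (v : 𝒢.graph.Vertex)
    (h : 𝒢.graph.abuts b = some v) : F.conjElt b v h = F.conjugator b v h := by
  change Classical.choose (F.comm b v h) =
    Classical.choose (F.exists_conj b v h _ rfl (F.base.edgeOf_branchMap b))
  apply classicalChoose_congr
  funext g
  apply propext
  refine forall_congr' fun x => ?_
  have e1 : ((ℋ.brHomAt (F.base.branchMap b) (F.base.vertexMap v) (F.base.abuts_branchMap b v h)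
      (F.base.edgeMap (𝒢.graph.edgeOf b)) (F.base.edgeOf_branchMap b)).comp
      (F.hEAt (𝒢.graph.edgeOf b) (F.base.edgeMap (𝒢.graph.edgeOf b)) rfl)) x =
      ℋ.brHom (F.base.branchMap b) (F.base.vertexMap v) (F.base.abuts_branchMap b v h)
        (F.base.edgeOf_branchMap b ▸ F.hE (𝒢.graph.edgeOf b) x) :=
    brHomAt_apply _ _ _ (F.base.edgeOf_branchMap b) _
  constructor
  · intro h1
    rw [e1]
    exact h1.symm
  · intro h1
    rw [e1] at h1
    exact h1.symm

/-! ### Element-level bookkeeping for the §2 pull-back along `F.toAnab` -/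

/-- The re-indexing isomorphism of `PullbackFunctor.lean` acts on underlying elements as the transport
along the equality of edges. [cite: MochizukiSemiAnbd2006, Rem. 2.11.1 p.32] -/
theorem toAnab_reindexIso_inv_app_apply (e : 𝒢.graph.Edge) (f : ℋ.graph.Edge)
    (p : F.base.edgeMap e = f) (X : ℋ.toAnab.BObj) (y : (X.T (F.base.edgeMap e)).obj.V) :
    ((F.toAnab.reindexIso e f (F.toAnab.base.edgeMap e) p rfl).inv.app X).hom.hom y =
      (p ▸ y : (X.T f).obj.V) := by
  subst p
  rfl

/-- The inverse 2-cells of `F.toAnab` act by the conjugating element `g = conjElt` on underlying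
sets. [cite: MochizukiSemiAnbd2006, Rmk 2.4.2 p.26] -/
theorem toAnab_φB_inv_app_apply (b : 𝒢.graph.Branch) (v : 𝒢.graph.Vertex)
    (h : 𝒢.graph.abuts b = some v) (Y : BCat (ℋ.Gv (F.base.vertexMap v))) (x : Y.obj.V) :
    ((F.toAnab.φB b v h).inv.app Y).hom.hom x = (F.conjElt b v h • x : Y.obj.V) := by
  change ((resIsoOfConj _ _ (F.conjElt b v h) (F.conjElt_spec b v h)).inv.app Y).hom.hom x = _
  exact resIsoOfConj_inv_app_apply _ _ _ _ Y x

/-- **The gluing of the covering underlying `F.toAnab^* X` along a branch `b`**: transport along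
`edgeOf (F b) = F (edgeOf b)`, the gluing of (the covering underlying) `X` along `F b`, then the action
of the chosen conjugating element — literally the formula of `covPullback_glue_apply` for the §3
pull-back, with `conjElt` for `conjugator`. [cite: MochizukiSemiAnbd2006, Prop 3.6(iv) p.39] -/
theorem ofBObj_toAnab_pullback_glue_apply (X : ℋ.toAnab.BObj) (b : 𝒢.graph.Branch)
    (v : 𝒢.graph.Vertex) (h : 𝒢.graph.abuts b = some v)
    (y : ((𝒢.ofBObj.obj (F.toAnab.pullbackFunctor.obj X)).SE (𝒢.graph.edgeOf b)).obj.V) :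
    ((𝒢.ofBObj.obj (F.toAnab.pullbackFunctor.obj X)).glue b v h).hom.hom.hom y =
      ((ℋ.ofBObj.obj X).SV (F.base.vertexMap v)).obj.ρ (F.conjElt b v h)
        (((ℋ.ofBObj.obj X).glue (F.base.branchMap b) (F.base.vertexMap v)
            (F.base.abuts_branchMap b v h)).hom.hom.hom (F.base.edgeOf_branchMap b ▸ y)) := by
  have step : ((𝒢.ofBObj.obj (F.toAnab.pullbackFunctor.obj X)).glue b v h).hom.hom.hom y =
      ((F.toAnab.φB b v h).inv.app (X.S (F.base.vertexMap v))).hom.hom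
        ((X.ψ (F.base.branchMap b) (F.base.vertexMap v) (F.base.abuts_branchMap b v h)).inv.hom.hom
          (((F.toAnab.reindexIso (𝒢.graph.edgeOf b) _ _ (F.base.edgeOf_branchMap b).symm rfl).inv.app
              X).hom.hom y)) := rfl
  rw [step, toAnab_reindexIso_inv_app_apply, toAnab_φB_inv_app_apply]
  rfl

/-! ### The comparison isomorphism `F.toAnab^* ⋙ ofBObj ≅ ofBObj ⋙ F^*` -/

/-- **B7c, functor level**: pulling a finite étale covering of `ℋ` back along the §2 morphism
`F.toAnab` and then regarding it as a covering of `𝒢` IS (canonically isomorphic to, by identity maps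
on all fibres) regarding it as a covering of `ℋ` and pulling back along `F` in `B^cov`
([SemiAnbd] Prop. 3.6 (iv) "by pulling back … coverings"; Def. 3.5 (i) "`B(G) ↪ B^cov(G)`").
[cite: MochizukiSemiAnbd2006, Prop 3.6(iv) p.39] -/
def toAnabPullbackIso : F.toAnab.pullbackFunctor ⋙ 𝒢.ofBObj ≅ ℋ.ofBObj ⋙ F.covPullback :=
  NatIso.ofComponents
    (fun X => CovObj.isoOfComponents
      (fun v => (temperedAction _).isoMk (Action.mkIso (Iso.refl _) (fun _ => rfl)))
      (fun e => (temperedAction _).isoMk (Action.mkIso (Iso.refl _) (fun _ => rfl)))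
      (fun b v h => by
        apply ObjectProperty.hom_ext
        apply Action.Hom.ext
        refine ConcreteCategory.hom_ext _ _ fun y => ?_
        change ((F.covPullback.obj (ℋ.ofBObj.obj X)).glue b v h).hom.hom.hom y =
          ((𝒢.ofBObj.obj (F.toAnab.pullbackFunctor.obj X)).glue b v h).hom.hom.hom y
        rw [covPullback_glue_apply, ofBObj_toAnab_pullback_glue_apply, conjElt_eq_conjugator]))
    (fun {X Y} g => by
      refine CovHom.ext (funext fun v => ?_) (funext fun e => ?_)
      · apply ObjectProperty.hom_ext
        apply Action.Hom.ext
        refine ConcreteCategory.hom_ext _ _ fun y => ?_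
        rfl
      · apply ObjectProperty.hom_ext
        apply Action.Hom.ext
        refine ConcreteCategory.hom_ext _ _ fun y => ?_
        rfl)

/-- The comparison isomorphism is the identity on vertex fibres. [cite: MochizukiSemiAnbd2006, Prop 3.6(iv) p.39] -/
@[simp] theorem toAnabPullbackIso_hom_app_fV_apply (X : ℋ.toAnab.BObj) (v : 𝒢.graph.Vertex)
    (x : ((𝒢.ofBObj.obj (F.toAnab.pullbackFunctor.obj X)).SV v).obj.V) :
    ((F.toAnabPullbackIso.hom.app X).fV v).hom.hom x = x := rfl

/-- The comparison isomorphism is the identity on edge fibres. [cite: MochizukiSemiAnbd2006, Prop 3.6(iv) p.39] -/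
@[simp] theorem toAnabPullbackIso_hom_app_fE_apply (X : ℋ.toAnab.BObj) (e : 𝒢.graph.Edge)
    (x : ((𝒢.ofBObj.obj (F.toAnab.pullbackFunctor.obj X)).SE e).obj.V) :
    ((F.toAnabPullbackIso.hom.app X).fE e).hom.hom x = x := rfl

/-- The inverse comparison isomorphism is the identity on vertex fibres. [cite: MochizukiSemiAnbd2006, Prop 3.6(iv) p.39] -/
@[simp] theorem toAnabPullbackIso_inv_app_fV_apply (X : ℋ.toAnab.BObj) (v : 𝒢.graph.Vertex)
    (x : ((F.covPullback.obj (ℋ.ofBObj.obj X)).SV v).obj.V) :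
    ((F.toAnabPullbackIso.inv.app X).fV v).hom.hom x = x := rfl

/-- The inverse comparison isomorphism is the identity on edge fibres. [cite: MochizukiSemiAnbd2006, Prop 3.6(iv) p.39] -/
@[simp] theorem toAnabPullbackIso_inv_app_fE_apply (X : ℋ.toAnab.BObj) (e : 𝒢.graph.Edge)
    (x : ((F.covPullback.obj (ℋ.ofBObj.obj X)).SE e).obj.V) :
    ((F.toAnabPullbackIso.inv.app X).fE e).hom.hom x = x := rfl

/-! ### Finite objects: `F^*` on `BFinCat` and the chart-shaped comparison through `equivBFin` -/

/-- `F^*` restricted to the finite objects: `BFinCat ℋ ⥤ BFinCat 𝒢` (finite étale coverings pull back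
to finite étale coverings, [SemiAnbd] p. 23 "`B' ×_B 𝒢_v`" / Prop. 3.6 (iv)).
[cite: MochizukiSemiAnbd2006, Prop 3.6(iv) p.39] -/
def bfinPullback : BFinCat ℋ ⥤ BFinCat 𝒢 :=
  ObjectProperty.lift _ (ObjectProperty.ι _ ⋙ F.covPullback) fun S => F.isFinite_covPullback S.property

/-- `F^*` on `BFinCat` lies over `F^*` on `B^cov` (definitional). [cite: MochizukiSemiAnbd2006, Prop 3.6(iv) p.39] -/
theorem bfinPullback_comp_ι :
    F.bfinPullback ⋙ ObjectProperty.ι _ = ObjectProperty.ι _ ⋙ F.covPullback := rfl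

/-- **B7c, finite-object level**: `F.toAnab^* ⋙ ofBObjFin ≅ ofBObjFin ⋙ F^*|_{BFin}` (the comparison
isomorphism `toAnabPullbackIso`, lifted to the full subcategories of finite objects).
[cite: MochizukiSemiAnbd2006, Prop 3.6(iv) p.39] -/
def toAnabPullbackIsoFin :
    F.toAnab.pullbackFunctor ⋙ 𝒢.ofBObjFin ≅ ℋ.ofBObjFin ⋙ F.bfinPullback :=
  NatIso.ofComponents
    (fun X => (ObjectProperty.fullyFaithfulι _).preimageIso (F.toAnabPullbackIso.app X))
    (fun g => ObjectProperty.hom_ext _ (F.toAnabPullbackIso.hom.naturality g))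

/-- **B7c, chart-shaped**: the §3 pull-back on finite étale coverings IS the §2 pull-back functor of
`F.toAnab`, read through the equivalences `equivBFin : B(−.toAnab) ≌ BFinCat (−)` of
`FiniteCoveringsGalois.lean` — the finite analogue of the shape of `Hom.Induces`
(`B^temp(φ) ≅ c_H⁻¹ ⋙ F^* ⋙ c_G`). [cite: MochizukiSemiAnbd2006, Prop 3.6(iv) p.39] -/
def bfinPullbackIso :
    F.bfinPullback ≅ ℋ.equivBFin.inverse ⋙ F.toAnab.pullbackFunctor ⋙ 𝒢.equivBFin.functor :=
  (Functor.leftUnitor _).symm ≪≫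
    Functor.isoWhiskerRight ℋ.equivBFin.counitIso.symm F.bfinPullback ≪≫
    Functor.associator _ _ _ ≪≫
    Functor.isoWhiskerLeft ℋ.equivBFin.inverse F.toAnabPullbackIsoFin.symm

end Hom

/-! ### Tempered objects and charts -/

variable (𝒢) in
/-- `B(𝒢) ⥤ B^temp(𝒢)`: finite étale coverings as tempered coverings ([SemiAnbd] Def. 3.5 (ii) p. 37
"`B(G) ↪ B^temp(G)`"), over the hypothesis that finite objects are tempered (supplied by
`FiniteIsTempered_holds` for connected countable `𝒢`). [cite: MochizukiSemiAnbd2006, Def 3.5(ii) p.37] -/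
def ofBObjTemp (h𝒢 : ∀ S : CovObj 𝒢, S.IsFinite → S.IsTempered) : 𝒢.toAnab.BObj ⥤ BTempCat 𝒢 :=
  ObjectProperty.lift _ 𝒢.ofBObj fun X => h𝒢 _ (𝒢.ofBObj_isFinite X)

/-- `ofBObjTemp` lies over `ofBObj` (definitional). [cite: MochizukiSemiAnbd2006, Def 3.5(ii) p.37] -/
theorem ofBObjTemp_comp_ι (h𝒢 : ∀ S : CovObj 𝒢, S.IsFinite → S.IsTempered) :
    𝒢.ofBObjTemp h𝒢 ⋙ ObjectProperty.ι _ = 𝒢.ofBObj := rfl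

/-- For connected countable `𝒢` the hypothesis of `ofBObjTemp` holds (`FiniteIsTempered_holds`).
[cite: MochizukiSemiAnbd2006, Def 3.5(ii) p.37] -/
theorem isTempered_of_isFinite (hc : 𝒢.graph.IsConnected) (hκ : 𝒢.IsCountable) :
    ∀ S : CovObj 𝒢, S.IsFinite → S.IsTempered :=
  FiniteIsTempered_holds 𝒢 hc hκ

namespace Hom

variable (F : Hom 𝒢 ℋ)

/-- **B7c, tempered level**: `F.toAnab^* ⋙ ofBObjTemp ≅ ofBObjTemp ⋙ F^*|_{B^temp}` — pulling back along
`F.toAnab` in `B(−)` and along `F` in `B^temp(−)` (`btempPullback`, [SemiAnbd] Prop. 3.6 (iv)) agree on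
finite étale coverings. [cite: MochizukiSemiAnbd2006, Prop 3.6(iv) p.39] -/
def toAnabPullbackIsoTemp (h𝒢 : ∀ S : CovObj 𝒢, S.IsFinite → S.IsTempered)
    (hℋ : ∀ S : CovObj ℋ, S.IsFinite → S.IsTempered) :
    F.toAnab.pullbackFunctor ⋙ 𝒢.ofBObjTemp h𝒢 ≅ ℋ.ofBObjTemp hℋ ⋙ F.btempPullback :=
  NatIso.ofComponents
    (fun X => (ObjectProperty.fullyFaithfulι _).preimageIso (F.toAnabPullbackIso.app X))
    (fun g => ObjectProperty.hom_ext _ (F.toAnabPullbackIso.hom.naturality g))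

variable {F} in
/-- **B7c at the level of tempered fundamental groups (charts)** ([SemiAnbd] Prop. 3.6 (iv) p. 39 with
Prop. 3.6 (ii) "`B^temp(π₁^temp(G)) ⥲ B^temp(G)`"): if `φ : π₁^temp(𝒢) → π₁^temp(ℋ)` is induced by `F`
through the charts — `B^temp(φ) ≅ c_ℋ⁻¹ ⋙ F^* ⋙ c_𝒢 = F.chartPullback c𝒢 cℋ`, which is LITERALLY the
body of `Hom.Induces c𝒢 cℋ φ` (`TemperedReconstruction.lean` v2) and of `Hom.InducesWith
F.chosenConjugators c𝒢 cℋ φ` (ruling ξ2, v3; `chartPullback_eq_chartPullbackWith` is `rfl`), stated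
here in the unfolded form of `conj_of_chartPullback_iso` so that no supersede of that file touches it —
then on finite étale coverings presented in `B(ℋ.toAnab)`, restricting the chart action along `φ` is
pulling back along `F.toAnab` and charting: `ofBObjTemp ⋙ c_ℋ ⋙ B^temp(φ) ≅ F.toAnab^* ⋙ ofBObjTemp ⋙ c_𝒢`.
(The group-level compatibility of the induced homomorphisms with the profinite completions follows by
transport of structure; the every-`θ` form replaces `chartPullback`/`toAnab` by `chartPullbackWith θ` /
`toAnabWith θ` with the same proof.) [cite: MochizukiSemiAnbd2006, Prop 3.6(iv) p.39] -/
theorem chart_res_iso_of_chartPullback_iso {c𝒢 : TemperedPiChart 𝒢} {cℋ : TemperedPiChart ℋ}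
    {φ : c𝒢.G →ₜ* cℋ.G} (hF : Nonempty (F.chartPullback c𝒢 cℋ ≅ BTemp.res φ))
    (h𝒢 : ∀ S : CovObj 𝒢, S.IsFinite → S.IsTempered)
    (hℋ : ∀ S : CovObj ℋ, S.IsFinite → S.IsTempered) :
    Nonempty (ℋ.ofBObjTemp hℋ ⋙ cℋ.equiv.functor ⋙ BTemp.res φ ≅
      F.toAnab.pullbackFunctor ⋙ 𝒢.ofBObjTemp h𝒢 ⋙ c𝒢.equiv.functor) := by
  obtain ⟨i⟩ := hF
  exact ⟨Functor.isoWhiskerLeft _ (Functor.isoWhiskerLeft _ i.symm) ≪≫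
    Functor.isoWhiskerLeft _ (Functor.associator _ _ _).symm ≪≫
    Functor.isoWhiskerLeft _ (Functor.isoWhiskerRight cℋ.equiv.unitIso.symm _) ≪≫
    Functor.isoWhiskerLeft _ (Functor.leftUnitor _) ≪≫
    (Functor.associator _ _ _).symm ≪≫
    Functor.isoWhiskerRight (F.toAnabPullbackIsoTemp h𝒢 hℋ).symm _ ≪≫
    Functor.associator _ _ _⟩

end Hom

end ProfiniteSemiGraph

end Literature.AnabelianGeometry.SemiGraphs

end
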